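/-
Copyright (c) 2026 The HCML crux team. All rights reserved.
Released under Apache 2.0 license as described in the file LICENSE.
Authors: K2E5-p17 (g4) (explicit-unit `hodgecm-mathlib-K2E5-p17-g4`)
-/
import Summits.HodgeConjecture.HodgeConjecture.Theorems.K2E3CuspFormCancellationPolychotomyTransport  -- ★ (A′) p858201 (this seat): (A) over `W × ι`, level one
import Summits.HodgeConjecture.HodgeConjecture.Theorems.K2E3GL3CuspFormCancellationCover            -- ★ (B-val) parts 1–2 (this seat): pieces, deep level, covers
import Summits.HodgeConjecture.HodgeConjecture.Theorems.K2E3GLnCongruenceIwahoriTriple              -- ★ (B-Iw) p858151 (K2E3-p21 (g5)): Iwahori orders, `permGL`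
import Summits.HodgeConjecture.HodgeConjecture.Theorems.K2E3GL3ModCentre                            -- ★ GL-P: `secondCountableTopology_gl3`, `locallyCompactSpace_gl3`
import Summits.HodgeConjecture.HodgeConjecture.Theorems.K2E3GLnCongruenceIwahoriOrders              -- ★ (B-Iw) FILE 2 p858317 (K2E3-p21 (g5)): Iwahori orders, any labels (Borel)
import Literature.NumberTheory.Automorphic.UnipotentRadicalCompactOpenProofs                        -- ★ `isClosed_unipotentRadicalGL`
import Literature.NumberTheory.Automorphic.GLnLocalUnimodular                                       -- ★ `GLn.isMulRightInvariant_of_isHaarMeasure_local`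
import HarnessLib

/-!
# K2_E3 road (h413), U12 «Characters» — THEOREM 20 (HARISH-CHANDRA'S CUSP-FORM CANCELLATION) FOR `GL₃(F)`, UPSTAIRS: for `y ∈ 𝔅_s` and `x ∉ 𝔅_R`,
# `∫_{GL₃(𝒪)} f(x k y) dk = 0` — `Γ = A` the split torus (`R = m_C + 6(m + 2s + 4m_C) + s`); the rank-one torus `{diag(λ,λ,μ)}` of the mixed Cartan is the sequel
# `K2E3GL3CuspFormCancellationBlockScalar` (`R = m_C + (m + 2s + 4m_C) + s`)

Cell `pub/hodgecm-mathlib` (D-0151), Track B, seat K2E5-p17 (g4); line lead K2E3-p23 (g5) (BLUEPRINT v4 §2 «T20-GL₃», RULINGS #12 (M12-3), (M12-5)), co-owner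
K2E3-p21 (g5) (★ (B-Iw), (D) the cusp-form discharge), dealer K2E3-plan (g3).  `--supports stmt-HodgeConjecture-24833 --as helper`; THEOREMS ONLY (no definition ∕
instance ∕ notation ∕ named fact ∕ `sorry`); never imports `Cruxes/…/Lines`.  COUNT-NEUTRAL.  Consumer: FILE (C′) `K2E3GL3CuspFormCancellationQuot` (the shells
`∫_{Ω n ∖ Ω R} θ(x g x⁻¹) dx = 0` on `G_Λ = GL₃(F) ⧸ Λ·1`) and the road's ASM.

THE MATHEMATICS [HarishChandra1970, Part VII §2 Theorem 20 p. 70; §3 p. 71; §8 pp. 80–84].  `G = GL₃(F)` upstairs, scale-invariant height balls `Ω k = 𝔅_k`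
(★ B4-0: `∀ i j k l, |ϖ^k g_{ij}(g⁻¹)_{kl}| ≤ 1`), level `K₀ = K_m = congruenceGL 3 (valuation F ϖ ^ m)` (`m ≥ 1`), deep levels `L j = K_j`, full level
`K₁ = GL₃(𝒪) = glInt 3 F`, a continuous `f` with `supp f ⊆ 𝔅_{m_C} · Γ`.
* `Γ = A = M_{id}` (the diagonal torus; T18-split ★ p858074 puts the slices `x ↦ θ(x γ x⁻¹)`, `γ ∈ A^{reg}`, in this shape): ★ (A′)
  `cuspForm_cancellation_polychotomy_levelOne_of_base` with `W = S₃` acting through the permutation matrices `w_σ = permGL σ ∈ GL₃(𝒪)` (they normalise `K_j`, `𝔅_k`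
  and `A`), BASE directions `r ∈ Fin 3`: BOREL `(V,T,U) = (N̄_B, A, N_B)` (labels `id`), `(1,2)`: `(N̄_{(1,2)}, M_{(1,2)}, N_{(1,2)})` (labels `![0,1,1]`), `(2,1)` (labels
  `![0,0,1]`), pieces = ★ (B-val) with `E := m + 2s + 4m_C`, depths `E+1`, `5E+1`, `5E+1`, defects `0`, `E+E`, `E+E`, radius `6E`; `hIw` = ★ (B-Iw) FILES 1–2; `hV`∕`hT`∕`hnormU`∕`hcontr`∕`h54`∕`hdeep`∕`hK₀` = ★ (B-val) part 1; `hcover` = ★ (B-val) part 2 `cover_of_not_adBall`.  The cusp-form hypothesis is the HONEST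
  transported one: `∫_{U_r} f(x · w_σ u w_σ⁻¹) du = 0` for all `σ, r, x` and every Haar measure (discharged for supercuspidal slices by (D), ★ B4-J∕B4-E1∕B4-A1).
* §1 GL₃ dictionary: `permGL` conjugation of diagonals and of `𝔅_k`; memberships in `A` and in `A₃ = {diag(λ,λ,μ)} = M_{id} ⊓ C(M_{(2,1)})` (the split component of the
  Levi `M_{(2,1)} ⊃ T_E`, used by the sequel).  §2 **`cuspForm_cancellation_GL3_split`**.

HONEST LABEL: HC_CM is proved only modulo the 7 printed citations (2 remaining named inputs: hLiu418 = stmt-HodgeConjecture-24832, h413 = stmt-HodgeConjecture-24833)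
until rung 0 closes; count-neutral helper (Theorem 20 is an intermediate of (SC-an), not a printed citation of HC_CM).

## References
* [HarishChandra1970] Harish-Chandra (notes by G. van Dijk), *Harmonic Analysis on Reductive p-adic Groups*, LNM 162 (1970), Part VII §2 Thm. 20 p. 70, §3 p. 71, §8 pp. 80–84.
* [Casselman1995] W. Casselman, *Introduction to the theory of admissible representations of p-adic reductive groups* (1995), Prop. 1.4.3–1.4.4.
* [BernsteinZelevinsky1977] I. N. Bernstein, A. V. Zelevinsky, Ann. Sci. ÉNS 10 (1977), §2.1.
-/

set_option autoImplicit false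
set_option linter.dupNamespace false   -- `Summit.HodgeConjecture.HodgeConjecture.…` (D-0017 nested layout; lakefile exemption for Summits)

noncomputable section

open scoped MatrixGroups WithZero Pointwise
open MeasureTheory MeasureTheory.Measure Matrix ValuativeRel Topology
open Literature.NumberTheory.Automorphic
open Summit.HodgeConjecture.HodgeConjecture.Cruxes.H413.K2E3GLnAdHeightBalls
open Summit.HodgeConjecture.HodgeConjecture.Cruxes.H413.K2E3GLnUnipotentAdHeight
open Summit.HodgeConjecture.HodgeConjecture.Cruxes.H413.K2E3GLnCuspFormCancellationInputs
open Summit.HodgeConjecture.HodgeConjecture.Cruxes.H413.K2E3GL3CuspFormCancellationCover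
open Summit.HodgeConjecture.HodgeConjecture.Cruxes.H413.K2E3GLnCongruenceIwahoriTriple
open Summit.HodgeConjecture.HodgeConjecture.Cruxes.H413.K2E3CuspFormCancellationPolychotomyTransport

namespace Summit.HodgeConjecture.HodgeConjecture.Cruxes.H413.K2E3GL3CuspFormCancellation

/-! ## §1 The GL₃ dictionary -/

section Dictionary

variable {F : Type*} [Field F] {n : ℕ}

/-- **CONJUGATING A DIAGONAL BY A PERMUTATION MATRIX**: `(permGL ω)⁻¹ · diag(d) · permGL ω = diag(d ∘ ω⁻¹)` (★ `permMatrix_mul_diagonal`).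
[cite: HarishChandra1970, Part VII §8 p. 80 (`s ∈ W`)] -/
theorem coe_permGL_inv_mul_mul_permGL (ω : Equiv.Perm (Fin n)) {t : GL (Fin n) F} {d : Fin n → F} (ht : (t : Matrix (Fin n) (Fin n) F) = Matrix.diagonal d) :
    (((permGL ω)⁻¹ * t * permGL ω : GL (Fin n) F) : Matrix (Fin n) (Fin n) F) = Matrix.diagonal (d ∘ ⇑ω⁻¹) := by
  have hd : (d ∘ ⇑ω⁻¹) ∘ ⇑ω = d := funext fun i => by simp [Equiv.Perm.inv_def]
  have h1 : Matrix.diagonal d * ((permGL ω : GL (Fin n) F) : Matrix (Fin n) (Fin n) F) =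
      ((permGL ω : GL (Fin n) F) : Matrix (Fin n) (Fin n) F) * Matrix.diagonal (d ∘ ⇑ω⁻¹) := by
    rw [coe_permGL, permMatrix_mul_diagonal, hd]
  rw [Units.val_mul, Units.val_mul, mul_assoc, ht, h1, ← mul_assoc, Units.inv_mul, one_mul]

/-- A matrix in the Levi of the labelling `id` (all blocks of size one) is the diagonal of its diagonal entries. [cite: BernsteinZelevinsky1977, §2.1] -/
theorem coe_eq_diagonal_of_mem_standardLeviGL_id {a : GL (Fin n) F} (ha : a ∈ standardLeviGL F (id : Fin n → Fin n)) :
    (a : Matrix (Fin n) (Fin n) F) = Matrix.diagonal fun i => (a : Matrix (Fin n) (Fin n) F) i i := by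
  ext i j
  by_cases hij : i = j
  · subst hij; rw [Matrix.diagonal_apply_eq]
  · rw [Matrix.diagonal_apply_ne _ hij, (mem_standardLeviGL_iff (id : Fin n → Fin n) a).1 ha i j hij]

/-- `permGL` conjugation preserves the diagonal torus `A = M_{id}`. [cite: HarishChandra1970, Part VII §8 p. 80] -/
theorem permGL_inv_mul_mul_permGL_mem_standardLeviGL_id (ω : Equiv.Perm (Fin n)) {a : GL (Fin n) F} (ha : a ∈ standardLeviGL F (id : Fin n → Fin n)) :
    (permGL ω)⁻¹ * a * permGL ω ∈ standardLeviGL F (id : Fin n → Fin n) :=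
  mem_standardLeviGL_of_coe_eq_diagonal id (coe_permGL_inv_mul_mul_permGL ω (coe_eq_diagonal_of_mem_standardLeviGL_id ha))

/-- **THE SPLIT COMPONENT `A₃ = {diag(λ,λ,μ)}` OF THE LEVI `M_{(2,1)}`** as «diagonal matrices centralising `M_{(2,1)}`»: membership forces `d₀ = d₁` (commute with the
elementary unipotent `1 + E_{01} ∈ M_{(2,1)}`). [cite: HarishChandra1970, Part VII §8 p. 80 (`A` = split component of `M`)] -/
theorem apply_zero_zero_eq_of_mem_centralizer {a : GL (Fin 3) F} (ha : a ∈ standardLeviGL F (id : Fin 3 → Fin 3))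
    (hc : a ∈ Subgroup.centralizer ((standardLeviGL F (![0, 0, 1] : Fin 3 → Fin 2) : Subgroup (GL (Fin 3) F)) : Set (GL (Fin 3) F))) :
    (a : Matrix (Fin 3) (Fin 3) F) 0 0 = (a : Matrix (Fin 3) (Fin 3) F) 1 1 := by
  -- the elementary unipotent `m = 1 + E_{01}` lies in `M_{(2,1)}`
  set m : GL (Fin 3) F := ⟨!![1, 1, 0; 0, 1, 0; 0, 0, 1], !![1, -1, 0; 0, 1, 0; 0, 0, 1], by simp [Matrix.one_fin_three],
    by simp [Matrix.one_fin_three]⟩ with hm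
  have hmM : m ∈ standardLeviGL F (![0, 0, 1] : Fin 3 → Fin 2) := by
    refine (mem_standardLeviGL_iff _ m).2 fun i j hij => ?_
    fin_cases i <;> fin_cases j <;> simp [hm] at hij ⊢
  have hcomm := Subgroup.mem_centralizer_iff.1 hc m hmM
  have hd := coe_eq_diagonal_of_mem_standardLeviGL_id ha
  have h01 := congrArg (fun g : GL (Fin 3) F => (g : Matrix (Fin 3) (Fin 3) F) 0 1) hcomm
  simp only [Units.val_mul] at h01
  rw [hd, Matrix.mul_diagonal, Matrix.diagonal_mul] at h01
  rw [eq_comm]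
  simpa [hm] using h01

/-- Conversely `diag(λ, λ, μ)` centralises `M_{(2,1)}` (so T18-mixed's split parts lie in `A₃`). [cite: HarishChandra1970, Part VII §8 p. 80] -/
theorem mem_centralizer_of_coe_eq_diagonal {a : GL (Fin 3) F} {d : Fin 3 → F} (ha : (a : Matrix (Fin 3) (Fin 3) F) = Matrix.diagonal d) (h01 : d 0 = d 1) :
    a ∈ Subgroup.centralizer ((standardLeviGL F (![0, 0, 1] : Fin 3 → Fin 2) : Subgroup (GL (Fin 3) F)) : Set (GL (Fin 3) F)) := by
  refine Subgroup.mem_centralizer_iff.2 fun m hm => Units.ext ?_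
  have hm' := (mem_standardLeviGL_iff (![0, 0, 1] : Fin 3 → Fin 2) m).1 hm
  rw [Units.val_mul, Units.val_mul, ha]
  ext i j
  rw [Matrix.mul_diagonal, Matrix.diagonal_mul]
  by_cases hij : (![0, 0, 1] : Fin 3 → Fin 2) i = (![0, 0, 1] : Fin 3 → Fin 2) j
  · have hdij : d i = d j := by
      fin_cases i <;> fin_cases j <;> simp at hij ⊢ <;> first | exact h01 | exact h01.symm
    rw [hdij, mul_comm]
  · rw [hm' i j hij, mul_zero, zero_mul]

variable [Valued F ℤᵐ⁰] [ValuativeRel F] [(Valued.v : Valuation F ℤᵐ⁰).Compatible]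

/-- Entries of an element of `GL_n(𝒪)` and of its inverse have `Valued.v ≤ 1` (★ bridge `mem_glInt_iff_forall_v_le_one`). [cite: CartierCorvallis1979, §IV.1] -/
theorem forall_v_le_one_of_mem_glInt {w : GL (Fin n) F} (hw : w ∈ glInt n F) :
    (∀ i j, Valued.v ((w : Matrix (Fin n) (Fin n) F) i j) ≤ 1) ∧ ∀ i j, Valued.v (((w⁻¹ : GL (Fin n) F) : Matrix (Fin n) (Fin n) F) i j) ≤ 1 :=
  (mem_glInt_iff_forall_v_le_one w).1 hw

/-- **`𝔅_k` IS NORMALISED BY `GL_n(𝒪)`**: `𝔅_k(w g w⁻¹) ↔ 𝔅_k(g)` for `w ∈ GL_n(𝒪)` (★ B4-0 bi-invariance). [cite: HarishChandra1970, Part VII §2 p. 69] -/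
theorem adBall_conj_iff_of_mem_glInt (ϖ : F) (k : ℕ) {w : GL (Fin n) F} (hw : w ∈ glInt n F) (g : GL (Fin n) F) :
    (∀ i j a b, Valued.v (ϖ ^ k * (((w * g * w⁻¹ : GL (Fin n) F) : Matrix (Fin n) (Fin n) F) i j * (((w * g * w⁻¹)⁻¹ : GL (Fin n) F) : Matrix (Fin n) (Fin n) F) a b)) ≤ 1) ↔
      ∀ i j a b, Valued.v (ϖ ^ k * ((g : Matrix (Fin n) (Fin n) F) i j * ((g⁻¹ : GL (Fin n) F) : Matrix (Fin n) (Fin n) F) a b)) ≤ 1 := by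
  obtain ⟨h1, h2⟩ := forall_v_le_one_of_mem_glInt hw
  obtain ⟨h3, h4⟩ := forall_v_le_one_of_mem_glInt (Subgroup.inv_mem _ hw)
  rw [adBall_mul_right_iff ϖ k h3 h4, adBall_mul_left_iff ϖ k h1 h2]

/-- **`GL₃(𝒪) ⊆ 𝔅_0`**. [cite: HarishChandra1970, Part VII §2 p. 69] -/
theorem adBall_zero_of_mem_glInt (ϖ : F) {k : GL (Fin n) F} (hk : k ∈ glInt n F) :
    ∀ i j a b, Valued.v (ϖ ^ 0 * ((k : Matrix (Fin n) (Fin n) F) i j * ((k⁻¹ : GL (Fin n) F) : Matrix (Fin n) (Fin n) F) a b)) ≤ 1 :=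
  adBall_zero_of_forall_v_le_one ϖ (forall_v_le_one_of_mem_glInt hk).1 (forall_v_le_one_of_mem_glInt hk).2

end Dictionary

/-! ## §2 Theorem 20 for `GL₃(F)`, `Γ = A` (the split torus): six chambers × three regimes -/

section Split

variable {F : Type*} [Field F] [Valued F ℤᵐ⁰] [ValuativeRel F] [(Valued.v : Valuation F ℤᵐ⁰).Compatible] [IsNonarchimedeanLocalField F]
  [MeasurableSpace (GL (Fin 3) F)] [BorelSpace (GL (Fin 3) F)]
  {E' : Type*} [NormedAddCommGroup E'] [NormedSpace ℝ E']

/-- **THEOREM 20 FOR `GL₃(F)` ON THE FULL LEVEL `K₁ = GL₃(𝒪)`, SPLIT TORUS.**  Let `m ≥ 1`, `y ∈ 𝔅_s`, `μ` a Haar measure on `GL₃(F)` (automatically right invariant,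
★ `GLn.isMulRightInvariant_of_isHaarMeasure_local`), `f` continuous with `supp f ⊆ 𝔅_{m_C} · A` (`A = M_{id}` the diagonal torus), and suppose the HONEST cusp
conditions: for every chamber `σ ∈ S₃`, every base radical `U ∈ {N_B, N_{(1,2)}, N_{(2,1)}}` (labels `id`, `![0,1,1]`, `![0,0,1]`), every Haar measure `ν₀` of `U` and every
`x`, `∫_U f(x · permGL σ · u · (permGL σ)⁻¹) dν₀(u) = 0`.  Then for every `x ∉ 𝔅_{m_C + 6(m + 2s + 4m_C) + s}`:  **`∫_{k ∈ GL₃(𝒪)} f(x k y) dμ(k) = 0`.**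
★ (A′) `cuspForm_cancellation_polychotomy_levelOne_of_base` with `W = S₃`, `ι = Fin 3`, all structural inputs ★ (B-val)∕(B-Iw)∕B4-0.
[cite: HarishChandra1970, Part VII §2 Theorem 20 p. 70; §3 p. 71; §8 pp. 80–84] [cite: Casselman1995, Prop. 1.4.3–1.4.4] -/
theorem cuspForm_cancellation_GL3_split {ϖ : F} (hϖ : Valued.v ϖ = WithZero.exp (-1 : ℤ)) (μ : Measure (GL (Fin 3) F)) [μ.IsHaarMeasure]
    {m : ℕ} (hm : 1 ≤ m) {s : ℕ} {y : GL (Fin 3) F}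
    (hy : ∀ i j k l, Valued.v (ϖ ^ s * ((y : Matrix (Fin 3) (Fin 3) F) i j * ((y⁻¹ : GL (Fin 3) F) : Matrix (Fin 3) (Fin 3) F) k l)) ≤ 1)
    (f : GL (Fin 3) F → E') (hf : Continuous f) {mC : ℕ}
    (hsupp : ∀ g, f g ≠ 0 → g ∈ {x : GL (Fin 3) F | ∀ i j k l, Valued.v (ϖ ^ mC * ((x : Matrix (Fin 3) (Fin 3) F) i j *
      ((x⁻¹ : GL (Fin 3) F) : Matrix (Fin 3) (Fin 3) F) k l)) ≤ 1} * ((standardLeviGL F (id : Fin 3 → Fin 3) : Subgroup (GL (Fin 3) F)) : Set (GL (Fin 3) F)))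
    (hcuspB : ∀ (σ : Equiv.Perm (Fin 3)) (ν₀ : Measure ↥(unipotentRadicalGL F (id : Fin 3 → Fin 3))), ν₀.IsHaarMeasure →
      ∀ x : GL (Fin 3) F, ∫ u, f (x * (permGL σ * (u : GL (Fin 3) F) * (permGL σ)⁻¹)) ∂ν₀ = 0)
    (hcusp12 : ∀ (σ : Equiv.Perm (Fin 3)) (ν₀ : Measure ↥(unipotentRadicalGL F (![0, 1, 1] : Fin 3 → Fin 2))), ν₀.IsHaarMeasure →
      ∀ x : GL (Fin 3) F, ∫ u, f (x * (permGL σ * (u : GL (Fin 3) F) * (permGL σ)⁻¹)) ∂ν₀ = 0)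
    (hcusp21 : ∀ (σ : Equiv.Perm (Fin 3)) (ν₀ : Measure ↥(unipotentRadicalGL F (![0, 0, 1] : Fin 3 → Fin 2))), ν₀.IsHaarMeasure →
      ∀ x : GL (Fin 3) F, ∫ u, f (x * (permGL σ * (u : GL (Fin 3) F) * (permGL σ)⁻¹)) ∂ν₀ = 0)
    {x : GL (Fin 3) F}
    (hx : ¬ ∀ i j k l, Valued.v (ϖ ^ (mC + 6 * (m + 2 * s + 4 * mC) + s) * ((x : Matrix (Fin 3) (Fin 3) F) i j *
      ((x⁻¹ : GL (Fin 3) F) : Matrix (Fin 3) (Fin 3) F) k l)) ≤ 1) :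
    ∫ k in ((glInt 3 F : Subgroup (GL (Fin 3) F)) : Set (GL (Fin 3) F)), f (x * k * y) ∂μ = 0 := by
  classical
  haveI : T2Space F := (Literature.NumberTheory.GaloisRepresentations.IsNonarchimedeanLocalField.isLocalField F).toT2Space
  haveI : SecondCountableTopology (GL (Fin 3) F) := K2E3GL3ModCentre.secondCountableTopology_gl3 F
  haveI : LocallyCompactSpace (GL (Fin 3) F) := K2E3GL3ModCentre.locallyCompactSpace_gl3 F
  haveI : μ.IsMulRightInvariant := GLn.isMulRightInvariant_of_isHaarMeasure_local 3 F μ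
  -- the uniformiser in both currencies
  have hϖ0 : ϖ ≠ 0 := ne_zero_of_v_eq_exp hϖ
  have hvϖ0 : valuation F ϖ ≠ 0 := (Valuation.ne_zero_iff _).2 hϖ0
  have hvϖ1 : valuation F ϖ < 1 := by
    rw [← v_lt_one_iff_valuation_lt_one, hϖ, ← WithZero.exp_zero, WithZero.exp_lt_exp]; norm_num
  have hγ1 : valuation F ϖ ^ m < 1 := pow_lt_one₀ zero_le hvϖ1 (by omega)
  have hγ0 : valuation F ϖ ^ m ≠ 0 := pow_ne_zero _ hvϖ0
  -- the objects
  set Ω : ℕ → Set (GL (Fin 3) F) := fun k => {g | ∀ i j a b, Valued.v (ϖ ^ k * ((g : Matrix (Fin 3) (Fin 3) F) i j *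
    ((g⁻¹ : GL (Fin 3) F) : Matrix (Fin 3) (Fin 3) F) a b)) ≤ 1} with hΩ
  have hΩmem : ∀ k g, g ∈ Ω k ↔ ∀ i j a b, Valued.v (ϖ ^ k * ((g : Matrix (Fin 3) (Fin 3) F) i j * ((g⁻¹ : GL (Fin 3) F) : Matrix (Fin 3) (Fin 3) F) a b)) ≤ 1 :=
    fun k g => Iff.rfl
  have hΩmul : ∀ {a b : ℕ} {g g' : GL (Fin 3) F}, g ∈ Ω a → g' ∈ Ω b → g * g' ∈ Ω (a + b) := fun hg hg' => adBall_mul hg hg'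
  have hΩinv : ∀ {a : ℕ} {g : GL (Fin 3) F}, g ∈ Ω a → g⁻¹ ∈ Ω a := fun {a} {g} hg =>
    (hΩmem a g⁻¹).2 (by simpa only [inv_inv] using adBall_inv hg)
  set K₀ : Subgroup (GL (Fin 3) F) := congruenceGL 3 (valuation F ϖ ^ m) with hK₀
  set L : ℕ → Subgroup (GL (Fin 3) F) := fun j => congruenceGL 3 (valuation F ϖ ^ j) with hL
  set A : Subgroup (GL (Fin 3) F) := standardLeviGL F (id : Fin 3 → Fin 3) with hA
  set E : ℕ := m + 2 * s + 4 * mC with hE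
  -- the three base directions
  set U : Fin 3 → Subgroup (GL (Fin 3) F) := ![unipotentRadicalGL F (id : Fin 3 → Fin 3), unipotentRadicalGL F (![0, 1, 1] : Fin 3 → Fin 2),
    unipotentRadicalGL F (![0, 0, 1] : Fin 3 → Fin 2)] with hU
  set V : Fin 3 → Subgroup (GL (Fin 3) F) := ![unipotentRadicalGL F (⇑OrderDual.toDual ∘ (id : Fin 3 → Fin 3)),
    unipotentRadicalGL F (⇑OrderDual.toDual ∘ (![0, 1, 1] : Fin 3 → Fin 2)), unipotentRadicalGL F (⇑OrderDual.toDual ∘ (![0, 0, 1] : Fin 3 → Fin 2))] with hV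
  set T : Fin 3 → Subgroup (GL (Fin 3) F) := ![standardLeviGL F (id : Fin 3 → Fin 3), standardLeviGL F (![0, 1, 1] : Fin 3 → Fin 2),
    standardLeviGL F (![0, 0, 1] : Fin 3 → Fin 2)] with hT
  set D : Fin 3 → ℕ := ![0, E + E, E + E] with hD
  set P : Fin 3 → Set (GL (Fin 3) F) := ![
    {a | ∃ d : Fin 3 → F, (a : Matrix (Fin 3) (Fin 3) F) = Matrix.diagonal d ∧
      (∀ i j : Fin 3, (id : Fin 3 → Fin 3) i < (id : Fin 3 → Fin 3) j → Valued.v ((d i)⁻¹ * d j) ≤ Valued.v (ϖ ^ (E + 1))) ∧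
        ∀ i j : Fin 3, (id : Fin 3 → Fin 3) i = (id : Fin 3 → Fin 3) j → Valued.v (ϖ ^ 0 * (d i * (d j)⁻¹)) ≤ 1},
    {a | ∃ d : Fin 3 → F, (a : Matrix (Fin 3) (Fin 3) F) = Matrix.diagonal d ∧
      (∀ i j : Fin 3, (![0, 1, 1] : Fin 3 → Fin 2) i < (![0, 1, 1] : Fin 3 → Fin 2) j → Valued.v ((d i)⁻¹ * d j) ≤ Valued.v (ϖ ^ (5 * E + 1))) ∧
        ∀ i j : Fin 3, (![0, 1, 1] : Fin 3 → Fin 2) i = (![0, 1, 1] : Fin 3 → Fin 2) j → Valued.v (ϖ ^ E * (d i * (d j)⁻¹)) ≤ 1},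
    {a | ∃ d : Fin 3 → F, (a : Matrix (Fin 3) (Fin 3) F) = Matrix.diagonal d ∧
      (∀ i j : Fin 3, (![0, 0, 1] : Fin 3 → Fin 2) i < (![0, 0, 1] : Fin 3 → Fin 2) j → Valued.v ((d i)⁻¹ * d j) ≤ Valued.v (ϖ ^ (5 * E + 1))) ∧
        ∀ i j : Fin 3, (![0, 0, 1] : Fin 3 → Fin 2) i = (![0, 0, 1] : Fin 3 → Fin 2) j → Valued.v (ϖ ^ E * (d i * (d j)⁻¹)) ≤ 1}] with hP
  set w : Equiv.Perm (Fin 3) → GL (Fin 3) F := fun σ => permGL σ with hw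
  -- the conjugators normalise `K_j`, `𝔅_k`, `A`
  have hwI : ∀ σ, w σ ∈ glInt 3 F := fun σ => permGL_mem_glInt σ
  have hwK : ∀ σ (j : ℕ), ∀ k ∈ congruenceGL 3 (valuation F ϖ ^ j), w σ * k * (w σ)⁻¹ ∈ congruenceGL 3 (valuation F ϖ ^ j) :=
    fun σ j k hk => conj_mem_congruenceGL_of_mem_glInt (hwI σ) hk
  have hwK' : ∀ σ (j : ℕ), ∀ k ∈ congruenceGL 3 (valuation F ϖ ^ j), (w σ)⁻¹ * k * w σ ∈ congruenceGL 3 (valuation F ϖ ^ j) := by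
    intro σ j k hk
    have h := conj_mem_congruenceGL_of_mem_glInt (Subgroup.inv_mem _ (hwI σ)) hk
    rwa [inv_inv] at h
  have hwΩ : ∀ σ (k : ℕ) (g : GL (Fin 3) F), g ∈ Ω k → w σ * g * (w σ)⁻¹ ∈ Ω k := fun σ k g hg =>
    (adBall_conj_iff_of_mem_glInt ϖ k (hwI σ) g).2 hg
  have hwΩ' : ∀ σ (k : ℕ) (g : GL (Fin 3) F), g ∈ Ω k → (w σ)⁻¹ * g * w σ ∈ Ω k := by
    intro σ k g hg
    have h := (adBall_conj_iff_of_mem_glInt ϖ k (Subgroup.inv_mem _ (hwI σ)) g).2 hg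
    exact (hΩmem k _).2 (by simpa only [inv_inv] using h)
  have hwA' : ∀ σ, ∀ a ∈ A, (w σ)⁻¹ * a * w σ ∈ A := fun σ a ha => permGL_inv_mul_mul_permGL_mem_standardLeviGL_id σ ha
  -- levels
  have hK₁Ω : ((glInt 3 F : Subgroup (GL (Fin 3) F)) : Set (GL (Fin 3) F)) ⊆ Ω 0 := fun k hk => adBall_zero_of_mem_glInt ϖ hk
  have hK₀K₁ : K₀ ≤ glInt 3 F := congruenceGL_le_glInt _
  have hK₁o : IsOpen ((glInt 3 F : Subgroup (GL (Fin 3) F)) : Set (GL (Fin 3) F)) := isOpen_glInt 3 F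
  have hK₁c : IsCompact ((glInt 3 F : Subgroup (GL (Fin 3) F)) : Set (GL (Fin 3) F)) := isCompact_glInt 3 F
  have hK₀o : IsOpen (K₀ : Set (GL (Fin 3) F)) := isOpen_congruenceGL hγ0
  have hK₀c : IsCompact (K₀ : Set (GL (Fin 3) F)) := isCompact_congruenceGL _
  have hdeep : ∀ u ∈ L (m + 2 * s), u ∈ K₀ ∧ y * u * y⁻¹ ∈ K₀ := by
    intro u hu
    have hu' : u ∈ congruenceGL 3 (valuation F ϖ ^ (m + s)) := congruenceGL_pow_le_pow hϖ (by omega) hu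
    exact ⟨congruenceGL_pow_le_pow hϖ (by omega) hu, conj_mem_congruenceGL_of_adBall hϖ hy hu'⟩
  have hUc : ∀ r, IsClosed ((U r : Subgroup (GL (Fin 3) F)) : Set (GL (Fin 3) F)) := by
    intro r; fin_cases r
    · exact isClosed_unipotentRadicalGL (id : Fin 3 → Fin 3)
    · exact isClosed_unipotentRadicalGL (![0, 1, 1] : Fin 3 → Fin 2)
    · exact isClosed_unipotentRadicalGL (![0, 0, 1] : Fin 3 → Fin 2)
  have hCΩ : {x : GL (Fin 3) F | ∀ i j k l, Valued.v (ϖ ^ mC * ((x : Matrix (Fin 3) (Fin 3) F) i j *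
      ((x⁻¹ : GL (Fin 3) F) : Matrix (Fin 3) (Fin 3) F) k l)) ≤ 1} ⊆ Ω mC := fun g hg => hg
  -- the honest cusp conditions, per base direction
  have hcusp : ∀ σ (r : Fin 3), ∀ ν₀ : Measure ↥(U r), ν₀.IsHaarMeasure → ∀ x : GL (Fin 3) F, ∫ u : ↥(U r), f (x * (w σ * ↑u * (w σ)⁻¹)) ∂ν₀ = 0 := by
    intro σ r; fin_cases r
    · exact hcuspB σ
    · exact hcusp12 σ
    · exact hcusp21 σ
  -- the cover: chamber × regime
  have hcover : ∀ a ∈ A, a ∉ Ω (6 * E) → ∃ σ r, (w σ)⁻¹ * a * w σ ∈ P r := by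
    intro a ha haR
    have hd := coe_eq_diagonal_of_mem_standardLeviGL_id ha
    obtain ⟨σ, hσ⟩ := cover_of_not_adBall hϖ hd (le_refl (6 * E)) haR
    have hconj := coe_permGL_inv_mul_mul_permGL σ⁻¹ hd
    rw [inv_inv] at hconj
    refine ⟨σ⁻¹, ?_⟩
    rcases hσ with ⟨h1, h2⟩ | ⟨h1, h2⟩ | ⟨h1, h2⟩
    · exact ⟨0, _, hconj, h1, h2⟩
    · exact ⟨1, _, hconj, h1, h2⟩
    · exact ⟨2, _, hconj, h1, h2⟩
  -- the six structural hypotheses, per base direction (★ (B-Iw), ★ `iwahoriDatumGL`, ★ (B-val))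
  have hIw : ∀ r, ∀ k ∈ K₀, ∃ v ∈ K₀ ⊓ V r, ∃ t ∈ K₀ ⊓ T r, ∃ u ∈ K₀ ⊓ U r, k = v * t * u := by
    intro r k hk; fin_cases r
    · exact K2E3GLnCongruenceIwahoriOrders.forall_exists_mul_of_coe_eq_mul
        (K2E3GLnCongruenceIwahoriOrders.coe_congruenceGL_eq_mul_iwahori (id : Fin 3 → Fin 3) hγ1) k hk
    · exact exists_iwahori_vtu_of_mem_congruenceGL hγ1 hk
    · exact exists_iwahori_vtu_of_mem_congruenceGL hγ1 hk
  have h54 : ∀ r, ∀ u ∈ U r, ∀ a' ∈ A, ∀ k : ℕ, u * a' ∈ Ω k → u ∈ Ω (2 * k) := by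
    intro r u hu a' ha' k huk
    have hd' := coe_eq_diagonal_of_mem_standardLeviGL_id ha'
    fin_cases r
    · exact adBall_two_mul_of_mem_unipotentRadicalGL (id : Fin 3 → Fin 3) ϖ hd' hu huk
    · exact adBall_two_mul_of_mem_unipotentRadicalGL (![0, 1, 1] : Fin 3 → Fin 2) ϖ hd' hu huk
    · exact adBall_two_mul_of_mem_unipotentRadicalGL (![0, 0, 1] : Fin 3 → Fin 2) ϖ hd' hu huk
  have hϖh1 : ∀ h : ℕ, Valued.v (ϖ ^ h) ≤ 1 := fun h => by
    rw [CartanUnique.v_uniformizer_pow hϖ h, ← WithZero.exp_zero, WithZero.exp_le_exp]; omega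
  have hV' : ∀ r, ∀ a ∈ P r, ∀ v ∈ K₀ ⊓ V r, a * v * a⁻¹ ∈ K₀ := by
    intro r a ha v hv; fin_cases r
    · obtain ⟨d, hd, h1, -⟩ := ha
      exact conj_mem_congruenceGL_of_mem_oppositeRadical (id : Fin 3 → Fin 3) hd (fun i j hij => (h1 i j hij).trans (hϖh1 _))
        (Subgroup.mem_inf.1 hv).1 (Subgroup.mem_inf.1 hv).2
    · obtain ⟨d, hd, h1, -⟩ := ha
      exact conj_mem_congruenceGL_of_mem_oppositeRadical (![0, 1, 1] : Fin 3 → Fin 2) hd (fun i j hij => (h1 i j hij).trans (hϖh1 _))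
        (Subgroup.mem_inf.1 hv).1 (Subgroup.mem_inf.1 hv).2
    · obtain ⟨d, hd, h1, -⟩ := ha
      exact conj_mem_congruenceGL_of_mem_oppositeRadical (![0, 0, 1] : Fin 3 → Fin 2) hd (fun i j hij => (h1 i j hij).trans (hϖh1 _))
        (Subgroup.mem_inf.1 hv).1 (Subgroup.mem_inf.1 hv).2
  have hT' : ∀ r, ∀ a ∈ P r, ∀ t ∈ K₀ ⊓ T r, a * t * a⁻¹ ∈ Ω (D r) := by
    intro r a ha t ht; fin_cases r
    · obtain ⟨d, hd, -, h2⟩ := ha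
      exact adBall_conj_of_mem_standardLeviGL (id : Fin 3 → Fin 3) ϖ hd h2 (Subgroup.mem_inf.1 ht).1 (Subgroup.mem_inf.1 ht).2
    · obtain ⟨d, hd, -, h2⟩ := ha
      exact adBall_conj_of_mem_standardLeviGL (![0, 1, 1] : Fin 3 → Fin 2) ϖ hd h2 (Subgroup.mem_inf.1 ht).1 (Subgroup.mem_inf.1 ht).2
    · obtain ⟨d, hd, -, h2⟩ := ha
      exact adBall_conj_of_mem_standardLeviGL (![0, 0, 1] : Fin 3 → Fin 2) ϖ hd h2 (Subgroup.mem_inf.1 ht).1 (Subgroup.mem_inf.1 ht).2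
  have hnormU : ∀ r, ∀ a ∈ P r, ∀ u ∈ U r, a * u * a⁻¹ ∈ U r := by
    intro r a ha u hu; fin_cases r
    · obtain ⟨d, hd, -, -⟩ := ha; exact conj_mem_unipotentRadicalGL_of_coe_eq_diagonal (id : Fin 3 → Fin 3) hd hu
    · obtain ⟨d, hd, -, -⟩ := ha; exact conj_mem_unipotentRadicalGL_of_coe_eq_diagonal (![0, 1, 1] : Fin 3 → Fin 2) hd hu
    · obtain ⟨d, hd, -, -⟩ := ha; exact conj_mem_unipotentRadicalGL_of_coe_eq_diagonal (![0, 0, 1] : Fin 3 → Fin 2) hd hu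
  have hcontr : ∀ r, ∀ a ∈ P r, ∀ (k j : ℕ), j + k ≤ m + 2 * s + (4 * mC + 2 * D r) + 1 → ∀ u ∈ U r, u ∈ Ω k → a⁻¹ * u * a ∈ L j := by
    intro r a ha k j hjk u hu huk; fin_cases r
    · obtain ⟨d, hd, h1, -⟩ := ha
      exact inv_conj_mem_congruenceGL_of_adBall (id : Fin 3 → Fin 3) hϖ hd h1 hu huk (by simp [hD] at hjk; omega)
    · obtain ⟨d, hd, h1, -⟩ := ha
      exact inv_conj_mem_congruenceGL_of_adBall (![0, 1, 1] : Fin 3 → Fin 2) hϖ hd h1 hu huk (by simp [hD] at hjk; omega)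
    · obtain ⟨d, hd, h1, -⟩ := ha
      exact inv_conj_mem_congruenceGL_of_adBall (![0, 0, 1] : Fin 3 → Fin 2) hϖ hd h1 hu huk (by simp [hD] at hjk; omega)
  -- assemble: ★ (A′) on the level `K₁ = GL₃(𝒪)`
  have hx' : x ∉ Ω (mC + 6 * E + s) := hx
  exact cuspForm_cancellation_polychotomy_levelOne_of_base μ Ω hΩmul hΩinv (glInt 3 F) K₀ A T U V P D L w
    (fun σ k hk => hwK σ m k hk) (fun σ k hk => hwK' σ m k hk) hwΩ hwΩ' (fun σ j g hg => hwK σ j g hg) hwA'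
    hK₁Ω hK₀K₁ hK₁o hK₁c hK₀o hK₀c hy hdeep hUc f hf _ hCΩ hsupp hcusp hcover hIw h54 hV' hT' hnormU hcontr hx'

end Split

end Summit.HodgeConjecture.HodgeConjecture.Cruxes.H413.K2E3GL3CuspFormCancellation

end
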